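import Summits.Ventures.PercRepro.S1PoorCapTotalThree
import Summits.Ventures.PercRepro.S1CoreCapSpecFiveCases
import Summits.Ventures.PercRepro.S1CoreCapSixCases
import Summits.Ventures.PercRepro.S1FiveCircuitsSolidSixSharp

/-!
# PercRepro — `s₅ ≤ 89` ON THE `(13, 6)` CORE AND `s₅ ≤ 146` ON THE `(13, 7)` CORE, UNCONDITIONALLY (p1, gen 34)

`proofs/P1-S2-CORANK6.md` §4o. PART 1 — the four-circuits of a plane-poor 8-spread matroid of nullity `4` / `5` / `6`
number at most `17` / `28` / `44`: the per-point caps at nullities `5` and `6` come for free from the landed plain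
instances `fourCapSpec_five` (`Q*(5) = 11`) and `fourCapSpec_six` (`Q*(6) = 16`) through the plane-poor bridge
(`tPoor_five_le_eleven`, `tPoor_six_le_sixteen`), and the deletion recursion gives the totals `8 + 9`, `11 + 17`,
`16 + 28` (`ncard_fourCircuits_le_seventeen_of_nullity_four`, `…_twenty_eight_of_nullity_five`,
`…_forty_four_of_nullity_six`, on the nullity-`3` bound `9` of `S1PoorCapTotalThree`).
PART 2 — the solid analysis of §4l bounds the five-circuits through a point `e` of a spread e-free core by a Case split:
CASE 1 (a rank-`4` flat through `e` with `7` points) is the landed `16` / `28` / `max 40 (q₅ + 15)`; CASE 2 (`M ／ {e}`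
plane-poor) is the number of four-circuits of the plane-poor 8-spread matroid `M ／ {e}` — now the TOTAL bounds of Part 1
instead of the per-point recursion's `18` (`ncard_fiveCircuitsThrough_le_max_of_planePoor_total`). So every point of a
spread e-free core of nullity `4` / `5` / `6` lies on at most `17` / `28` / `44` five-circuits, and the landed averaging
assemblies give **`ncard_fiveCircuits_le_eighty_nine_thirteen_six`**: `s₅ ≤ ⌊19·(21 + 17 + 28)/14⌋ = 89` on the
coloop-free spread e-free core of rank `13` on `19` points, and **`ncard_fiveCircuits_le_one_forty_six_thirteen_seven`**:
`s₅ ≤ ⌊20·(21 + 17 + 28 + 44)/15⌋ = 146` on the one of rank `13` on `20` points — both UNCONDITIONAL (axioms standard),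
meeting S2's targets `s₅ ≤ 90` (the rows `t ≤ 3` of `(13, 6)`) and `s₅ ≤ 150` (the rows `t ≥ 4` of `(13, 7)`).
-/

open scoped Matroid

namespace PercRepro

namespace S1

open Set

open FourCap

variable {α : Type}

/-- **The plane-poor spec at nullity `5` with `Q = 11`**, from the landed plain instance `fourCapSpec_five`. -/
theorem fourCapSpecPoor_five_eleven : FourCapSpecPoor capPoor 5 11 :=
  (FourCapSpecPoor.of_fourCapSpec fourCapSpec_five (by decide)).mono capPoor_le_capPaper

/-- **The plane-poor spec at nullity `6` with `Q = 16`**, from the landed plain instance `fourCapSpec_six`. -/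
theorem fourCapSpecPoor_six_sixteen : FourCapSpecPoor capPoor 6 16 :=
  (FourCapSpecPoor.of_fourCapSpec fourCapSpec_six (by decide)).mono capPoor_le_capPaper

/-- **At nullity `5`, a point of a plane-poor 8-spread matroid lies on at most `11` four-circuits.** -/
theorem tPoor_five_le_eleven (N : Matroid α) [N.Finite] (hpp : PlanePoor N) (hN8 : Spread8 N)
    (hd : N.E.encard = N.eRank + 5) (f : α) : {C : Set α | N.IsCircuit C ∧ C.ncard = 4 ∧ f ∈ C}.ncard ≤ 11 :=
  ncard_fourCircuitsThrough_le_of_fourCapSpecPoor' N hpp hN8 hd f fourCapSpecPoor_five_eleven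

/-- **At nullity `6`, a point of a plane-poor 8-spread matroid lies on at most `16` four-circuits.** -/
theorem tPoor_six_le_sixteen (N : Matroid α) [N.Finite] (hpp : PlanePoor N) (hN8 : Spread8 N)
    (hd : N.E.encard = N.eRank + 6) (f : α) : {C : Set α | N.IsCircuit C ∧ C.ncard = 4 ∧ f ∈ C}.ncard ≤ 16 :=
  ncard_fourCircuitsThrough_le_of_fourCapSpecPoor' N hpp hN8 hd f fourCapSpecPoor_six_sixteen

/-- **One deletion step of the recursion for the total count**: if every plane-poor 8-spread matroid of nullity `d` has
`≤ B` four-circuits and every point of one of nullity `d + 1` lies on `≤ q` four-circuits, then a plane-poor 8-spread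
matroid of nullity `d + 1` has `≤ q + B` four-circuits (delete a point of a four-circuit). -/
theorem ncard_fourCircuits_le_add_of_delete_step (N : Matroid α) [N.Finite] (hpp : PlanePoor N) (hN8 : Spread8 N)
    {d : ℕ} (hd : N.E.encard = N.eRank + (d + 1)) {q B : ℕ}
    (hq : ∀ x : α, {C : Set α | N.IsCircuit C ∧ C.ncard = 4 ∧ x ∈ C}.ncard ≤ q)
    (hB : ∀ (N' : Matroid α) [N'.Finite], PlanePoor N' → Spread8 N' → N'.E.encard = N'.eRank + d →
      {C : Set α | N'.IsCircuit C ∧ C.ncard = 4}.ncard ≤ B) :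
    {C : Set α | N.IsCircuit C ∧ C.ncard = 4}.ncard ≤ q + B := by
  classical
  by_cases hempty : {D : Set α | N.IsCircuit D ∧ D.ncard = 4} = ∅
  · rw [hempty, ncard_empty]; exact Nat.zero_le _
  obtain ⟨D₀, hD₀⟩ := nonempty_iff_ne_empty.2 hempty
  have hD₀4 : D₀.ncard = 4 := hD₀.2
  obtain ⟨x, hx⟩ : D₀.Nonempty := nonempty_of_ncard_ne_zero (by omega)
  have hxE : x ∈ N.E := hD₀.1.subset_ground hx
  have hxnc : ¬ N.IsColoop x := fun h => h.notMem_isCircuit hD₀.1 hx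
  have hd' : (N ＼ {x}).E.encard = (N ＼ {x}).eRank + d :=
    nullity_delete_singleton_of_not_isColoop N hxE hxnc hd
  have hsplit := ncard_fourCircuits_le_through_add_delete N x
  have h1 := hq x
  have h2 := hB (N ＼ {x}) (planePoor_delete N hpp x) (spread8_delete N hN8 x) hd'
  omega

/-- **A plane-poor 8-spread matroid of nullity `4` has at most `17` four-circuits** (`8 + 9`). -/
theorem ncard_fourCircuits_le_seventeen_of_nullity_four (N : Matroid α) [N.Finite] (hpp : PlanePoor N)
    (hN8 : Spread8 N) (hd : N.E.encard = N.eRank + 4) : {C : Set α | N.IsCircuit C ∧ C.ncard = 4}.ncard ≤ 17 :=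
  ncard_fourCircuits_le_add_of_delete_step N hpp hN8 (d := 3) (by rw [hd]; norm_num)
    (fun x => tPoor_four N hpp hN8 hd x)
    (fun N' _ hpp' hN8' hd' => ncard_fourCircuits_le_nine_of_nullity_three N' hpp' hN8' hd')

/-- **A plane-poor 8-spread matroid of nullity `5` has at most `28` four-circuits** (`11 + 17`). -/
theorem ncard_fourCircuits_le_twenty_eight_of_nullity_five (N : Matroid α) [N.Finite] (hpp : PlanePoor N)
    (hN8 : Spread8 N) (hd : N.E.encard = N.eRank + 5) : {C : Set α | N.IsCircuit C ∧ C.ncard = 4}.ncard ≤ 28 :=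
  ncard_fourCircuits_le_add_of_delete_step N hpp hN8 (d := 4) (by rw [hd]; norm_num)
    (fun x => tPoor_five_le_eleven N hpp hN8 hd x)
    (fun N' _ hpp' hN8' hd' => ncard_fourCircuits_le_seventeen_of_nullity_four N' hpp' hN8' hd')

/-- **A plane-poor 8-spread matroid of nullity `6` has at most `44` four-circuits** (`16 + 28`). -/
theorem ncard_fourCircuits_le_forty_four_of_nullity_six (N : Matroid α) [N.Finite] (hpp : PlanePoor N)
    (hN8 : Spread8 N) (hd : N.E.encard = N.eRank + 6) : {C : Set α | N.IsCircuit C ∧ C.ncard = 4}.ncard ≤ 44 :=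
  ncard_fourCircuits_le_add_of_delete_step N hpp hN8 (d := 5) (by rw [hd]; norm_num)
    (fun x => tPoor_six_le_sixteen N hpp hN8 hd x)
    (fun N' _ hpp' hN8' hd' => ncard_fourCircuits_le_twenty_eight_of_nullity_five N' hpp' hN8' hd')


/-! ### Part 2: the solid split with the total bounds, and the two cells -/

/-- **THE SOLID SPLIT WITH A TOTAL BOUND**: on a spread core of nullity `d` (e-freeness is only used inside Case 1), the five-circuits through `e` number at
most `max c B` whenever Case 1 (a rank-`4` flat through `e` with `7` points) gives `≤ c` and every plane-poor 8-spread matroid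
of nullity `d` has `≤ B` four-circuits (Case 2: `M ／ {e}` is such a matroid and `C ↦ C ∖ {e}` injects the five-circuits
through `e` into its four-circuits). -/
theorem ncard_fiveCircuitsThrough_le_max_of_planePoor_total (M : Matroid α) [M.Finite]
    (hns : ¬ ∃ W ⊆ M.E, W.ncard ≤ 9 ∧ W.encard = M.eRk W + 4) {d : ℕ} (hd : M.E.encard = M.eRank + d) (e : α)
    (c B : ℕ)
    (hcase1 : ∀ X : Set α, M.eRk X = 4 → e ∈ M.closure X → (M.closure X).ncard = 7 →
      {C : Set α | M.IsCircuit C ∧ C.ncard = 5 ∧ e ∈ C}.ncard ≤ c)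
    (htot : ∀ (N' : Matroid α) [N'.Finite], PlanePoor N' → Spread8 N' → N'.E.encard = N'.eRank + d →
      {D : Set α | N'.IsCircuit D ∧ D.ncard = 4}.ncard ≤ B) :
    {C : Set α | M.IsCircuit C ∧ C.ncard = 5 ∧ e ∈ C}.ncard ≤ max c B := by
  classical
  by_cases hempty : {C : Set α | M.IsCircuit C ∧ C.ncard = 5 ∧ e ∈ C} = ∅
  · rw [hempty, ncard_empty]; exact Nat.zero_le _
  obtain ⟨C₀, hC₀⟩ := nonempty_iff_ne_empty.2 hempty
  have heE : e ∈ M.E := hC₀.1.subset_ground hC₀.2.2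
  have hel : ¬ M.IsLoop e := by
    intro hl
    have h5 := hC₀.2.1
    rw [hl.eq_of_isCircuit_mem hC₀.1 hC₀.2.2, ncard_singleton] at h5
    exact absurd h5 (by norm_num)
  have henl : M.IsNonloop e := ⟨hel, heE⟩
  have hdN := nullity_contract_singleton_of_not_isLoop M heE hel hd
  by_cases hPP : PlanePoor (M ／ {e})
  · -- CASE 2: the total bound on the plane-poor 8-spread contraction
    calc {C : Set α | M.IsCircuit C ∧ C.ncard = 5 ∧ e ∈ C}.ncard
        ≤ {D : Set α | (M ／ {e}).IsCircuit D ∧ D.ncard = 4}.ncard :=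
          ncard_fiveCircuitsThrough_le_ncard_fourCircuits_contract M e
      _ ≤ B := htot (M ／ {e}) hPP (spread8_contract M hns henl) hdN
      _ ≤ max c B := le_max_right _ _
  · -- CASE 1: a four-circuit `D` of the contraction spans a 6-point plane, i.e. `cl_M(insert e D)` has `7` points
    unfold PlanePoor at hPP
    push Not at hPP
    obtain ⟨D, hD, h4, h6⟩ := hPP
    have hDE : D ⊆ M.E := hD.subset_ground.trans (M.contract_ground_subset_ground {e})
    have heD : e ∉ D := fun h => (hD.subset_ground h).2 (mem_singleton e)
    have hX4 : M.eRk (insert e D) = 4 := by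
      rw [← eRk_contract_singleton_add_one M henl hDE heD]
      have hDf : D.Finite := M.ground_finite.subset hDE
      have h := hD.eRk_add_one_eq
      rw [← hDf.cast_ncard_eq, h4] at h
      obtain ⟨r, hr⟩ := exists_eRk_eq_coe (M ／ {e}) D
      rw [hr] at h ⊢
      have h' : r + 1 = 4 := by exact_mod_cast h
      have : r = 3 := by omega
      rw [this]
      norm_num
    have heX : e ∈ M.closure (insert e D) := M.subset_closure _ (insert_subset heE hDE) (mem_insert e D)
    have hcl : (M ／ {e}).closure D = M.closure (insert e D) \ {e} := by
      rw [Matroid.contract_closure_eq, union_singleton]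
    have h7 : (M.closure (insert e D)).ncard = 7 := by
      have hle := S2.ncard_le_of_eRk_le_of_not_nullity M 4 9 (by norm_num) hns (M.closure_subset_ground _)
        (r := 4) (by norm_num) (by rw [M.eRk_closure_eq, hX4]; norm_num)
      have hge : 6 ≤ (M.closure (insert e D)).ncard - 1 := by
        rw [← ncard_sdiff_singleton_of_mem heX, ← hcl]
        omega
      omega
    exact (hcase1 (insert e D) hX4 heX h7).trans (le_max_left _ _)

/-- **Every point of a spread e-free core of nullity `4` lies on at most `17` five-circuits** (Case 1: `16`; Case 2: the total
`17` of the plane-poor 8-spread contraction). -/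
theorem ncard_fiveCircuitsThrough_le_seventeen_of_nullity_four (M : Matroid α) [M.Finite]
    (hfree : ∀ e ∈ M.E, ∃ A ⊆ M.E \ {e}, e ∉ M.closure A ∧ e ∉ M.closure ((M.E \ {e}) \ A))
    (hns : ¬ ∃ W ⊆ M.E, W.ncard ≤ 9 ∧ W.encard = M.eRk W + 4) (hd : M.E.encard = M.eRank + 4) (e : α) :
    {C : Set α | M.IsCircuit C ∧ C.ncard = 5 ∧ e ∈ C}.ncard ≤ 17 := by
  have h := ncard_fiveCircuitsThrough_le_max_of_planePoor_total M hns hd e 16 17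
    (fun X hX4 heX h7 => ncard_fiveCircuitsThrough_le_sixteen_of_seven_solid M hfree hns hd hX4 heX h7)
    (fun N' _ hpp' hN8' hd' => ncard_fourCircuits_le_seventeen_of_nullity_four N' hpp' hN8' hd')
  simpa using h

/-- **Every point of a spread e-free core of nullity `5` lies on at most `28` five-circuits** (Case 1: `28`; Case 2: `28`). -/
theorem ncard_fiveCircuitsThrough_le_twenty_eight_of_nullity_five (M : Matroid α) [M.Finite]
    (hfree : ∀ e ∈ M.E, ∃ A ⊆ M.E \ {e}, e ∉ M.closure A ∧ e ∉ M.closure ((M.E \ {e}) \ A))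
    (hns : ¬ ∃ W ⊆ M.E, W.ncard ≤ 9 ∧ W.encard = M.eRk W + 4) (hd : M.E.encard = M.eRank + 5) (e : α) :
    {C : Set α | M.IsCircuit C ∧ C.ncard = 5 ∧ e ∈ C}.ncard ≤ 28 := by
  have h := ncard_fiveCircuitsThrough_le_max_of_planePoor_total M hns hd e 28 28
    (fun X hX4 heX h7 => ncard_fiveCircuitsThrough_le_twenty_eight_of_seven_solid_five M hfree hns hd hX4 heX h7)
    (fun N' _ hpp' hN8' hd' => ncard_fourCircuits_le_twenty_eight_of_nullity_five N' hpp' hN8' hd')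
  simpa using h

/-- **Every point of a spread e-free core of nullity `6` lies on at most `44` five-circuits** (Case 1: `max 40 (28 + 15) = 43`;
Case 2: `44`). -/
theorem ncard_fiveCircuitsThrough_le_forty_four_of_nullity_six (M : Matroid α) [M.Finite]
    (hfree : ∀ e ∈ M.E, ∃ A ⊆ M.E \ {e}, e ∉ M.closure A ∧ e ∉ M.closure ((M.E \ {e}) \ A))
    (hns : ¬ ∃ W ⊆ M.E, W.ncard ≤ 9 ∧ W.encard = M.eRk W + 4) (hd : M.E.encard = M.eRank + 6) (e : α) :
    {C : Set α | M.IsCircuit C ∧ C.ncard = 5 ∧ e ∈ C}.ncard ≤ 44 := by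
  have h := ncard_fiveCircuitsThrough_le_max_of_planePoor_total M hns hd e 43 44
    (fun X hX4 heX h7 => by
      have := ncard_fiveCircuitsThrough_le_of_seven_solid_six_of_five M hfree hns hd hX4 heX h7 28
        (fun M' _ hfree' hns' hd' e' _ => ncard_fiveCircuitsThrough_le_twenty_eight_of_nullity_five M' hfree' hns' hd' e')
      simpa using this)
    (fun N' _ hpp' hN8' hd' => ncard_fourCircuits_le_forty_four_of_nullity_six N' hpp' hN8' hd')
  simpa using h

/-- **`s₅ ≤ 89` ON THE `(13, 6)` CORE, UNCONDITIONALLY**: the coloop-free spread e-free core of rank `13` on `19` points has at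
most `89` five-circuits (`⌊19·(21 + 17 + 28)/14⌋ = 89`). This is the requirement `s₅ ≤ 90` of the rows `t ≤ 3` of S2's
`(13, 6)` cf spread case. -/
theorem ncard_fiveCircuits_le_eighty_nine_thirteen_six (M : Matroid α) [M.Finite]
    (hfree : ∀ e ∈ M.E, ∃ A ⊆ M.E \ {e}, e ∉ M.closure A ∧ e ∉ M.closure ((M.E \ {e}) \ A))
    (hns : ¬ ∃ W ⊆ M.E, W.ncard ≤ 9 ∧ W.encard = M.eRk W + 4) (hd : M.E.encard = M.eRank + 6)
    (hn : M.E.ncard = 19) (hK : ∀ e, ¬ M.IsColoop e) :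
    {C : Set α | M.IsCircuit C ∧ C.ncard = 5}.ncard ≤ 89 := by
  have h := ncard_fiveCircuits_le_thirteen_six_of_perPoint_four_five M hfree hns hd hn hK 17 28
    (fun M' _ hfree' hns' hd' e _ => ncard_fiveCircuitsThrough_le_seventeen_of_nullity_four M' hfree' hns' hd' e)
    (fun M' _ hfree' hns' hd' e _ => ncard_fiveCircuitsThrough_le_twenty_eight_of_nullity_five M' hfree' hns' hd' e)
  exact h.trans (by norm_num)

/-- **`s₅ ≤ 146` ON THE `(13, 7)` CORE, UNCONDITIONALLY**: the coloop-free spread e-free core of rank `13` on `20` points has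
at most `146` five-circuits (`⌊20·(21 + 17 + 28 + 44)/15⌋ = 146 ≤ 150`, S2's target for the rows `t ≥ 4` of `(13, 7)`). -/
theorem ncard_fiveCircuits_le_one_forty_six_thirteen_seven (M : Matroid α) [M.Finite]
    (hfree : ∀ e ∈ M.E, ∃ A ⊆ M.E \ {e}, e ∉ M.closure A ∧ e ∉ M.closure ((M.E \ {e}) \ A))
    (hns : ¬ ∃ W ⊆ M.E, W.ncard ≤ 9 ∧ W.encard = M.eRk W + 4) (hd : M.E.encard = M.eRank + 7)
    (hn : M.E.ncard = 20) (hK : ∀ e, ¬ M.IsColoop e) :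
    {C : Set α | M.IsCircuit C ∧ C.ncard = 5}.ncard ≤ 146 := by
  have h := ncard_fiveCircuits_le_thirteen_seven_of_perPoint M hfree hns hd hn hK 17 28 44
    (fun M' _ hfree' hns' hd' e _ => ncard_fiveCircuitsThrough_le_seventeen_of_nullity_four M' hfree' hns' hd' e)
    (fun M' _ hfree' hns' hd' e _ => ncard_fiveCircuitsThrough_le_twenty_eight_of_nullity_five M' hfree' hns' hd' e)
    (fun M' _ hfree' hns' hd' e _ => ncard_fiveCircuitsThrough_le_forty_four_of_nullity_six M' hfree' hns' hd' e)
  exact h.trans (by norm_num)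

/-- **The nullity-`6` spread `s₅` cap for ANY point count, unconditionally**: on a coloop-free spread e-free core of nullity `6` on
`n > 5` points, `s₅ ≤ ⌊n·66/(n − 5)⌋` (`89` at `n = 19`, `91` at `18`, `93` at `17`). -/
theorem ncard_fiveCircuits_le_mul_div_nullity_six (M : Matroid α) [M.Finite]
    (hfree : ∀ e ∈ M.E, ∃ A ⊆ M.E \ {e}, e ∉ M.closure A ∧ e ∉ M.closure ((M.E \ {e}) \ A))
    (hns : ¬ ∃ W ⊆ M.E, W.ncard ≤ 9 ∧ W.encard = M.eRk W + 4) (hd : M.E.encard = M.eRank + 6)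
    {n : ℕ} (hn : M.E.ncard = n) (hn5 : 5 < n) (hK : ∀ e, ¬ M.IsColoop e) :
    {C : Set α | M.IsCircuit C ∧ C.ncard = 5}.ncard ≤ n * 66 / (n - 5) :=
  ncard_fiveCircuits_le_mul_div_spread_of M hfree hns (d := 5) (by rw [hd]; norm_num) hn hn5 hK
    (B := 66) (fun M' _ hfree' hns' hd' => by
      have h := ncard_fiveCircuits_le_of_perPoint_four_five M' hfree' hns' hd' 17 28
        (fun M'' _ hfree'' hns'' hd'' e _ => ncard_fiveCircuitsThrough_le_seventeen_of_nullity_four M'' hfree'' hns'' hd'' e)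
        (fun M'' _ hfree'' hns'' hd'' e _ => ncard_fiveCircuitsThrough_le_twenty_eight_of_nullity_five M'' hfree'' hns'' hd'' e)
      simpa using h)

/-- **The nullity-`7` spread `s₅` cap for ANY point count, unconditionally**: on a coloop-free spread e-free core of nullity `7` on
`n > 5` points, `s₅ ≤ ⌊n·110/(n − 5)⌋` (`146` at `n = 20`, `149` at `19`, `152` at `18` — the coloop sub-cells of `(13, 7)`). -/
theorem ncard_fiveCircuits_le_mul_div_nullity_seven (M : Matroid α) [M.Finite]
    (hfree : ∀ e ∈ M.E, ∃ A ⊆ M.E \ {e}, e ∉ M.closure A ∧ e ∉ M.closure ((M.E \ {e}) \ A))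
    (hns : ¬ ∃ W ⊆ M.E, W.ncard ≤ 9 ∧ W.encard = M.eRk W + 4) (hd : M.E.encard = M.eRank + 7)
    {n : ℕ} (hn : M.E.ncard = n) (hn5 : 5 < n) (hK : ∀ e, ¬ M.IsColoop e) :
    {C : Set α | M.IsCircuit C ∧ C.ncard = 5}.ncard ≤ n * 110 / (n - 5) :=
  ncard_fiveCircuits_le_mul_div_spread_of M hfree hns (d := 6) (by rw [hd]; norm_num) hn hn5 hK
    (B := 110) (fun M' _ hfree' hns' hd' => by
      have h := ncard_fiveCircuits_le_of_perPoint_four_five_six M' hfree' hns' hd' 17 28 44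
        (fun M'' _ hfree'' hns'' hd'' e _ => ncard_fiveCircuitsThrough_le_seventeen_of_nullity_four M'' hfree'' hns'' hd'' e)
        (fun M'' _ hfree'' hns'' hd'' e _ => ncard_fiveCircuitsThrough_le_twenty_eight_of_nullity_five M'' hfree'' hns'' hd'' e)
        (fun M'' _ hfree'' hns'' hd'' e _ => ncard_fiveCircuitsThrough_le_forty_four_of_nullity_six M'' hfree'' hns'' hd'' e)
      simpa using h)

end S1

end PercRepro
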